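import Summits.Ventures.PercRepro.S1CellTableAB
import Summits.Ventures.PercRepro.S1FlatBudget2

/-!
# PercRepro — S1 THE SUB-CASE COUNTS AT `d = 7, 8`: the flat profile with LEMMA E (p2, gen 16; SUBCLAIM-S1 §4 (A14),
§6.3 (vii))

At corank `d = 7` either two distinct rank-`4` flats have `≥ 9` points — then (LEMMA E) every circuit lies in
their union, `|S₀| ≤ 12`, and no flat has `10` points — or at most one flat has `≥ 9` points (the `RM` rate and
the constant `βK_7(10)`). At `d = 8`: a ten-point flat together with a nine-point one forces `|S₀| ≤ 13`; a
ten-point flat alone leaves the others at `≤ 8` points; no ten-point flat leaves the `RB9` rate with no constant.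

* `Uform` — the regrouped per-flat `U`-bound of a sub-case `(RB, K, mS)`; **`topCount_le_Uform`** — the
  regrouping packaged once; `fold_L1` — the L1 fold of a sub-case count;
* `eq_of_ten_le_ncard_of_flats'` — at `d ≤ 8` at most one ten-point flat;
* **`count_sub7`**, **`count_sub8`** — the case analyses: `7560·#U` is below the maximum of the sub-case forms.
Axioms: standard.
-/
open scoped Matroid

namespace PercRepro

namespace S1

open Set

variable {α : Type}

/-- **At corank `d ≤ 8` there is at most one rank-`4` flat with `10` points** (`10 + 10 > d + 11`). -/
theorem eq_of_ten_le_ncard_of_flats' (M : Matroid α) [M.Finite]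
    (hline : ∀ L ⊆ M.E, M.eRk L ≤ 2 → L.ncard ≤ 3) (hplane : ∀ P ⊆ M.E, M.eRk P ≤ 3 → P.ncard ≤ 6)
    {d : ℕ} (hd : M.E.encard = M.eRank + d) (hd8 : d ≤ 8) {F F' : Set α} (hF : F ⊆ M.E)
    (hclF : M.closure F = F) (hrF : M.eRk F = 4) (hF' : F' ⊆ M.E) (hclF' : M.closure F' = F')
    (hrF' : M.eRk F' = 4) (h10 : 10 ≤ F.ncard) (h10' : 10 ≤ F'.ncard) : F = F' := by
  by_contra hne
  have := ncard_add_ncard_le_of_flats_ne M hline hplane hd hF hclF hrF hF' hclF' hrF' hne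
  omega

/-- The regrouped per-flat `U`-bound of a sub-case with big rate `RB`, constant `K` and `|S₀| ≤ mS`
(ordinary binomials). -/
def Uform (p d RB K mS s3 s4 s5 : ℕ) : ℕ :=
  7560 * (p + d).choose 4 +
    (RSK d * (p + d - 3).choose 2 + (RB - RSK d) * (mS - 3).choose 2 - 7560 * (p + d - 3)) * s3 +
    (RSK d * (p + d - 4) + (RB - RSK d) * (mS - 4) - 7560) * s4 +
    (RSK d + (RB - RSK d)) * s5 + K

/-- The same with the kernel-evaluable binomial `CoreRegimes.chooseF`. -/
def UformF (p d RB K mS s3 s4 s5 : ℕ) : ℕ :=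
  7560 * CoreRegimes.chooseF (p + d) 4 +
    (RSK d * CoreRegimes.chooseF (p + d - 3) 2 + (RB - RSK d) * CoreRegimes.chooseF (mS - 3) 2 - 7560 * (p + d - 3)) * s3 +
    (RSK d * (p + d - 4) + (RB - RSK d) * (mS - 4) - 7560) * s4 +
    (RSK d + (RB - RSK d)) * s5 + K

/-- `UformF = Uform`. -/
theorem UformF_eq (p d RB K mS s3 s4 s5 : ℕ) : UformF p d RB K mS s3 s4 s5 = Uform p d RB K mS s3 s4 s5 := by
  unfold UformF Uform
  simp only [CoreRegimes.chooseF_eq]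

/-- **THE REGROUPING, PACKAGED**: from a sub-case count `7560·#{B : r(B) = 4, |B| ≤ d} + 7560·D₄ ≤ 7560·C(n, 4) +
RSK d·Π′_all + (RB − RSK d)·Π′_{mS} + K` (with the true circuit counts `s₃, s₄, s₅`) and the caps
`s₃ ≤ s3B`, `s₄ ≤ s4B`, `s₅ ≤ s5B`, `7560·#U ≤ Uform p d RB K mS s3B s4B s5B`. -/
theorem topCount_le_Uform (M : Matroid α) [M.Finite] (p d : ℕ) (hR : M.eRank = (p : ℕ∞))
    (hn : M.E.ncard = p + d) (hd : M.E.encard = M.eRank + d) (hp : 5 ≤ p) (hd4 : 4 ≤ d) (RB K mS : ℕ)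
    {s3B s4B s5B : ℕ}
    (hb3 : {C : Set α | M.IsCircuit C ∧ C.ncard = 3}.ncard ≤ s3B)
    (hb4 : {C : Set α | M.IsCircuit C ∧ C.ncard = 4}.ncard ≤ s4B)
    (hb5 : {C : Set α | M.IsCircuit C ∧ C.ncard = 5}.ncard ≤ s5B)
    (hU2 : 7560 * {B : Set α | B ⊆ M.E ∧ M.eRk B = 4 ∧ B.ncard ≤ d}.ncard +
      7560 * ({C : Set α | M.IsCircuit C ∧ C.ncard = 3}.ncard * (M.E.ncard - 3) +
        {C : Set α | M.IsCircuit C ∧ C.ncard = 4}.ncard) ≤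
      7560 * M.E.ncard.choose 4 +
      RSK d * ({C : Set α | M.IsCircuit C ∧ C.ncard = 3}.ncard * (M.E.ncard - 3).choose 2 +
        {C : Set α | M.IsCircuit C ∧ C.ncard = 4}.ncard * (M.E.ncard - 4) +
        {C : Set α | M.IsCircuit C ∧ C.ncard = 5}.ncard) +
      (RB - RSK d) * ({C : Set α | M.IsCircuit C ∧ C.ncard = 3}.ncard * (mS - 3).choose 2 +
        {C : Set α | M.IsCircuit C ∧ C.ncard = 4}.ncard * (mS - 4) +
        {C : Set α | M.IsCircuit C ∧ C.ncard = 5}.ncard) + K) :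
    7560 * Matroid.topCount M p 4 ≤ Uform p d RB K mS s3B s4B s5B := by
  classical
  have hU1 := topCount_le_ncard_eRk_eq_four_ncard_le M hR hd
  have hU0 : 7560 * Matroid.topCount M p 4 ≤
      7560 * {B : Set α | B ⊆ M.E ∧ M.eRk B = 4 ∧ B.ncard ≤ d}.ncard := Nat.mul_le_mul_left _ hU1
  rw [hn] at hU2
  set s3 := {C : Set α | M.IsCircuit C ∧ C.ncard = 3}.ncard with hs3
  set s4 := {C : Set α | M.IsCircuit C ∧ C.ncard = 4}.ncard with hs4
  set s5 := {C : Set α | M.IsCircuit C ∧ C.ncard = 5}.ncard with hs5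
  set piAll := s3 * (p + d - 3).choose 2 + s4 * (p + d - 4) + s5 with hpiAll
  set piS0 := s3 * (mS - 3).choose 2 + s4 * (mS - 4) + s5 with hpiS0
  set A3 := RSK d * (p + d - 3).choose 2 + (RB - RSK d) * (mS - 3).choose 2 with hA3
  set A4 := RSK d * (p + d - 4) + (RB - RSK d) * (mS - 4) with hA4
  set c5 := RSK d + (RB - RSK d) with hc5
  set c3 := A3 - 7560 * (p + d - 3) with hc3
  set c4 := A4 - 7560 with hc4
  have hRSK : 7560 ≤ RSK d := Nat.le_add_right _ _
  have hA3ge : 7560 * (p + d - 3) ≤ A3 := by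
    have h1 : p + d - 3 ≤ (p + d - 3).choose 2 := le_choose_two _ (by omega)
    calc 7560 * (p + d - 3) ≤ RSK d * (p + d - 3).choose 2 := Nat.mul_le_mul hRSK h1
      _ ≤ A3 := Nat.le_add_right _ _
  have hA4ge : 7560 ≤ A4 := by
    calc 7560 = 7560 * 1 := by ring
      _ ≤ RSK d * (p + d - 4) := Nat.mul_le_mul hRSK (by omega)
      _ ≤ A4 := Nat.le_add_right _ _
  have hA3eq : A3 = c3 + 7560 * (p + d - 3) := (Nat.sub_add_cancel hA3ge).symm
  have hA4eq : A4 = c4 + 7560 := (Nat.sub_add_cancel hA4ge).symm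
  have hident : RSK d * piAll + (RB - RSK d) * piS0 = A3 * s3 + A4 * s4 + c5 * s5 := by
    rw [hpiAll, hpiS0, hA3, hA4, hc5]; ring
  have hL : 7560 * {B : Set α | B ⊆ M.E ∧ M.eRk B = 4 ∧ B.ncard ≤ d}.ncard +
      7560 * (s3 * (p + d - 3) + s4) ≤
      7560 * (p + d).choose 4 + (A3 * s3 + A4 * s4 + c5 * s5) + K := by
    rw [← hident]
    have e : 7560 * (p + d).choose 4 + (RSK d * piAll + (RB - RSK d) * piS0) + K =
        7560 * (p + d).choose 4 + RSK d * piAll + (RB - RSK d) * piS0 + K := by ring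
    rw [e]
    exact hU2
  rw [hA3eq, hA4eq] at hL
  have hL' : 7560 * {B : Set α | B ⊆ M.E ∧ M.eRk B = 4 ∧ B.ncard ≤ d}.ncard ≤
      7560 * (p + d).choose 4 + (c3 * s3 + c4 * s4 + c5 * s5) + K := by
    have e : 7560 * (p + d).choose 4 + ((c3 + 7560 * (p + d - 3)) * s3 + (c4 + 7560) * s4 + c5 * s5) + K =
        7560 * (p + d).choose 4 + (c3 * s3 + c4 * s4 + c5 * s5) + K + 7560 * (s3 * (p + d - 3) + s4) := by
      ring
    rw [e] at hL
    omega
  unfold Uform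
  calc 7560 * Matroid.topCount M p 4
      ≤ 7560 * {B : Set α | B ⊆ M.E ∧ M.eRk B = 4 ∧ B.ncard ≤ d}.ncard := hU0
    _ ≤ 7560 * (p + d).choose 4 + (c3 * s3 + c4 * s4 + c5 * s5) + K := hL'
    _ ≤ 7560 * (p + d).choose 4 + c3 * s3B + c4 * s4B + c5 * s5B + K := by
        have h3 := Nat.mul_le_mul_left c3 hb3
        have h4 := Nat.mul_le_mul_left c4 hb4
        have h5 := Nat.mul_le_mul_left c5 hb5
        omega

/-- **THE L1 FOLD OF A SUB-CASE COUNT**: `7560·#{B : r(B) = 4, 5 ≤ |B| ≤ d} ≤ RSK d·Π′_all + (RB − RSK d)·Π′_{mS} + K`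
gives `7560·#{B : r(B) = 4, |B| ≤ d} + 7560·D₄ ≤ 7560·C(n, 4) + …` (`S1FourSetsLower`). -/
theorem fold_L1 (M : Matroid α) [M.Finite]
    (hline : ∀ L ⊆ M.E, M.eRk L ≤ 2 → L.ncard ≤ 3) (d RB K mS : ℕ)
    (hcore : 7560 * {B : Set α | B ⊆ M.E ∧ M.eRk B = 4 ∧ 5 ≤ B.ncard ∧ B.ncard ≤ d}.ncard ≤
      RSK d * ({C : Set α | M.IsCircuit C ∧ C.ncard = 3}.ncard * (M.E.ncard - 3).choose 2 +
        {C : Set α | M.IsCircuit C ∧ C.ncard = 4}.ncard * (M.E.ncard - 4) +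
        {C : Set α | M.IsCircuit C ∧ C.ncard = 5}.ncard) +
      (RB - RSK d) * ({C : Set α | M.IsCircuit C ∧ C.ncard = 3}.ncard * (mS - 3).choose 2 +
        {C : Set α | M.IsCircuit C ∧ C.ncard = 4}.ncard * (mS - 4) +
        {C : Set α | M.IsCircuit C ∧ C.ncard = 5}.ncard) + K) :
    7560 * {B : Set α | B ⊆ M.E ∧ M.eRk B = 4 ∧ B.ncard ≤ d}.ncard +
      7560 * ({C : Set α | M.IsCircuit C ∧ C.ncard = 3}.ncard * (M.E.ncard - 3) +
        {C : Set α | M.IsCircuit C ∧ C.ncard = 4}.ncard) ≤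
      7560 * M.E.ncard.choose 4 +
      RSK d * ({C : Set α | M.IsCircuit C ∧ C.ncard = 3}.ncard * (M.E.ncard - 3).choose 2 +
        {C : Set α | M.IsCircuit C ∧ C.ncard = 4}.ncard * (M.E.ncard - 4) +
        {C : Set α | M.IsCircuit C ∧ C.ncard = 5}.ncard) +
      (RB - RSK d) * ({C : Set α | M.IsCircuit C ∧ C.ncard = 3}.ncard * (mS - 3).choose 2 +
        {C : Set α | M.IsCircuit C ∧ C.ncard = 4}.ncard * (mS - 4) +
        {C : Set α | M.IsCircuit C ∧ C.ncard = 5}.ncard) + K := by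
  classical
  set S₁ := {B : Set α | B ⊆ M.E ∧ B.ncard = 4 ∧ M.eRk B = 4} with hS₁
  set S₂ := {B : Set α | B ⊆ M.E ∧ M.eRk B = 4 ∧ 5 ≤ B.ncard ∧ B.ncard ≤ d} with hS₂
  have hsplit : {B : Set α | B ⊆ M.E ∧ M.eRk B = 4 ∧ B.ncard ≤ d} ⊆ S₁ ∪ S₂ := by
    intro B hB
    have hBfin : B.Finite := M.ground_finite.subset hB.1
    have hle : 4 ≤ B.ncard := by
      have := M.eRk_le_encard B
      rw [hB.2.1, ← hBfin.cast_ncard_eq] at this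
      exact_mod_cast this
    rcases hle.lt_or_eq with h | h
    · exact Or.inr ⟨hB.1, hB.2.1, h, hB.2.2⟩
    · exact Or.inl ⟨hB.1, h.symm, hB.2.1⟩
  have hS₁fin : S₁.Finite := M.ground_finite.finite_subsets.subset (fun B hB => hB.1)
  have hS₂fin : S₂.Finite := M.ground_finite.finite_subsets.subset (fun B hB => hB.1)
  have hS₁card := ncard_four_sets_rank_four_add_le M hline
  have h1 : 7560 * {B : Set α | B ⊆ M.E ∧ M.eRk B = 4 ∧ B.ncard ≤ d}.ncard ≤ 7560 * (S₁.ncard + S₂.ncard) :=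
    calc 7560 * {B : Set α | B ⊆ M.E ∧ M.eRk B = 4 ∧ B.ncard ≤ d}.ncard
        ≤ 7560 * (S₁ ∪ S₂).ncard :=
          Nat.mul_le_mul_left _ (Set.ncard_le_ncard hsplit (hS₁fin.union hS₂fin))
      _ ≤ 7560 * (S₁.ncard + S₂.ncard) := Nat.mul_le_mul_left _ (Set.ncard_union_le _ _)
  have h2 : 7560 * (S₁.ncard + ({C : Set α | M.IsCircuit C ∧ C.ncard = 3}.ncard * (M.E.ncard - 3) +
      {C : Set α | M.IsCircuit C ∧ C.ncard = 4}.ncard)) ≤ 7560 * M.E.ncard.choose 4 :=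
    Nat.mul_le_mul_left _ hS₁card
  have := hcore
  rw [Nat.mul_add] at h1 h2
  omega

/-- A flat-family predicate: `F` is a rank-`4` flat of `M` with at least `t` points. -/
def BigFlat (M : Matroid α) (t : ℕ) (F : Set α) : Prop :=
  F ⊆ M.E ∧ M.closure F = F ∧ M.eRk F = 4 ∧ t ≤ F.ncard

/-- **THE SUB-CASE COUNT AT `d = 7`**: either (i) two distinct flats with `≥ 9` points exist — then the form
`(RB9 7, 0, 12)` — or (ii) the form `(RM 7, 7560·βK_7(10), min(35, n))`. Stated on `topCount` with the caps. -/
theorem count_sub7 (M : Matroid α) [M.Finite] (p : ℕ) (hR : M.eRank = (p : ℕ∞)) (hn : M.E.ncard = p + 7)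
    (hcirc : ∀ C, M.IsCircuit C → 3 ≤ C.encard)
    (hline : ∀ L ⊆ M.E, M.eRk L ≤ 2 → L.ncard ≤ 3) (hplane : ∀ P ⊆ M.E, M.eRk P ≤ 3 → P.ncard ≤ 6)
    (hten : ∀ X ⊆ M.E, M.eRk X ≤ 4 → X.ncard ≤ 10) (hd : M.E.encard = M.eRank + ((7 : ℕ) : ℕ∞)) (hp : 5 ≤ p)
    {s3B s4B s5B : ℕ}
    (hb3 : {C : Set α | M.IsCircuit C ∧ C.ncard = 3}.ncard ≤ s3B)
    (hb4 : {C : Set α | M.IsCircuit C ∧ C.ncard = 4}.ncard ≤ s4B)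
    (hb5 : {C : Set α | M.IsCircuit C ∧ C.ncard = 5}.ncard ≤ s5B) :
    7560 * Matroid.topCount M p 4 ≤
      max (Uform p 7 (RB9 7) 0 12 s3B s4B s5B)
        (Uform p 7 (RM 7) (7560 * betaK 10 7) (min 35 (p + 7)) s3B s4B s5B) := by
  classical
  by_cases htwo : ∃ F F' : Set α, BigFlat M 9 F ∧ BigFlat M 9 F' ∧ F ≠ F'
  · -- (i) two big flats: `|S₀| ≤ 12`, no ten-point flat
    obtain ⟨F, F', ⟨hF, hclF, hrF, h9⟩, ⟨hF', hclF', hrF', h9'⟩, hne⟩ := htwo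
    have hA := ncard_add_ncard_le_of_flats_ne M hline hplane hd hF hclF hrF hF' hclF' hrF' hne
    have hsum : F.ncard + F'.ncard = 7 + 11 := by omega
    have hS0 := ncard_sUnion_circuitsLE_le_of_flats_add_eq M hcirc hline hplane hd hF hclF hrF hF' hclF' hrF'
      hne hsum 5
    have hcore := ncard_rank4_Icc_le_engine M hcirc hline hplane hten 7 10 (RB9 7) 0 12 (by simpa using hS0) ?_ ?_
    · rw [zero_mul] at hcore
      refine le_max_of_le_left ?_
      exact topCount_le_Uform M p 7 hR hn hd hp (by norm_num) (RB9 7) 0 12 hb3 hb4 hb5 (fold_L1 M hline 7 (RB9 7) 0 12 hcore)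
    · -- the rate `RB9` for `8 ≤ |G| < 10` (as in `ncard_rank4_Icc_le_AB7`)
      intro G hG hcl hr h8 h10
      have h89 : G.ncard = 8 ∨ G.ncard = 9 := by omega
      rcases h89 with h | h
      · have hRM : RM 7 ≤ RB9 7 := by decide
        exact (weight_eight_AB M hcirc hline hplane hG hcl hr h 7).trans (Nat.mul_le_mul_right _ hRM)
      · exact weight_nine_AB M hline hplane hG hcl hr h 7
    · -- no ten-point flat: it would give `10 + 9 > 18` with `F`
      intro fl hfl
      have hemp : fl = ∅ := by
        rw [Finset.eq_empty_iff_forall_notMem]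
        intro G hG
        obtain ⟨hGE, hclG, hrG, h10⟩ := hfl G hG
        by_cases hGF : G = F
        · subst hGF; omega
        · have := ncard_add_ncard_le_of_flats_ne M hline hplane hd hGE hclG hrG hF hclF hrF hGF
          omega
      rw [hemp, Finset.card_empty]
  · -- (ii) at most one flat with `≥ 9` points
    push Not at htwo
    have hcore := ncard_rank4_Icc_le_engine M hcirc hline hplane hten 7 9 (RM 7) 1 (min (5 * 7) M.E.ncard)
      (ncard_sUnion_circuitsLE_le_min M hd) ?_ ?_
    · rw [one_mul] at hcore
      refine le_max_of_le_right ?_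
      have h := topCount_le_Uform M p 7 hR hn hd hp (by norm_num) (RM 7) (7560 * betaK 10 7) (min (5 * 7) M.E.ncard) hb3 hb4 hb5
        (fold_L1 M hline 7 (RM 7) (7560 * betaK 10 7) (min (5 * 7) M.E.ncard) hcore)
      rw [hn] at h
      exact h
    · intro G hG hcl hr h8 h9
      exact weight_eight_AB M hcirc hline hplane hG hcl hr (by omega) 7
    · intro fl hfl
      rw [Finset.card_le_one]
      intro G hG G' hG'
      obtain ⟨hGE, hclG, hrG, h9⟩ := hfl G hG
      obtain ⟨hGE', hclG', hrG', h9'⟩ := hfl G' hG'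
      exact htwo G G' ⟨hGE, hclG, hrG, h9⟩ ⟨hGE', hclG', hrG', h9'⟩

/-- **THE SUB-CASE COUNT AT `d = 8`**: (i-a) a ten-point and a nine-point flat — the form `(RB9 8, 7560·βK_8(10), 13)`;
(i-b) a ten-point flat and no other flat with `≥ 9` points — `(RM 8, 7560·βK_8(10), min(40, n))`; (ii) no ten-point
flat — `(RB9 8, 0, min(40, n))`. -/
theorem count_sub8 (M : Matroid α) [M.Finite] (p : ℕ) (hR : M.eRank = (p : ℕ∞)) (hn : M.E.ncard = p + 8)
    (hcirc : ∀ C, M.IsCircuit C → 3 ≤ C.encard)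
    (hline : ∀ L ⊆ M.E, M.eRk L ≤ 2 → L.ncard ≤ 3) (hplane : ∀ P ⊆ M.E, M.eRk P ≤ 3 → P.ncard ≤ 6)
    (hten : ∀ X ⊆ M.E, M.eRk X ≤ 4 → X.ncard ≤ 10) (hd : M.E.encard = M.eRank + ((8 : ℕ) : ℕ∞)) (hp : 5 ≤ p)
    {s3B s4B s5B : ℕ}
    (hb3 : {C : Set α | M.IsCircuit C ∧ C.ncard = 3}.ncard ≤ s3B)
    (hb4 : {C : Set α | M.IsCircuit C ∧ C.ncard = 4}.ncard ≤ s4B)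
    (hb5 : {C : Set α | M.IsCircuit C ∧ C.ncard = 5}.ncard ≤ s5B) :
    7560 * Matroid.topCount M p 4 ≤
      max (max (Uform p 8 (RB9 8) (7560 * betaK 10 8) 13 s3B s4B s5B)
          (Uform p 8 (RM 8) (7560 * betaK 10 8) (min 40 (p + 8)) s3B s4B s5B))
        (Uform p 8 (RB9 8) 0 (min 40 (p + 8)) s3B s4B s5B) := by
  classical
  have hRM : RM 8 ≤ RB9 8 := by decide
  have hw9 : ∀ G : Set α, G ⊆ M.E → M.closure G = G → M.eRk G = 4 → 8 ≤ G.ncard → G.ncard < 10 →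
      7560 * ((rank4Five M G).ncard + betaK G.ncard 8) ≤ RB9 8 * (pairsOf M G).ncard := by
    intro G hG hcl hr h8 h10
    have h89 : G.ncard = 8 ∨ G.ncard = 9 := by omega
    rcases h89 with h | h
    · exact (weight_eight_AB M hcirc hline hplane hG hcl hr h 8).trans (Nat.mul_le_mul_right _ hRM)
    · exact weight_nine_AB M hline hplane hG hcl hr h 8
  by_cases hten' : ∃ F : Set α, BigFlat M 10 F
  · obtain ⟨F, hF, hclF, hrF, h10⟩ := hten'
    have hF10 : F.ncard = 10 := le_antisymm (hten F hF hrF.le) h10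
    by_cases hnine : ∃ F' : Set α, BigFlat M 9 F' ∧ F' ≠ F
    · -- (i-a): `|S₀| ≤ 13`, at most one ten-point flat
      obtain ⟨F', ⟨hF', hclF', hrF', h9⟩, hne⟩ := hnine
      have hA := ncard_add_ncard_le_of_flats_ne M hline hplane hd hF hclF hrF hF' hclF' hrF' (Ne.symm hne)
      have hsum : F.ncard + F'.ncard = 8 + 11 := by omega
      have hS0 := ncard_sUnion_circuitsLE_le_of_flats_add_eq M hcirc hline hplane hd hF hclF hrF hF' hclF' hrF'
        (Ne.symm hne) hsum 5
      have hcore := ncard_rank4_Icc_le_engine M hcirc hline hplane hten 8 10 (RB9 8) 1 13 (by simpa using hS0)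
        hw9 ?_
      · rw [one_mul] at hcore
        refine le_max_of_le_left (le_max_of_le_left ?_)
        exact topCount_le_Uform M p 8 hR hn hd hp (by norm_num) (RB9 8) (7560 * betaK 10 8) 13 hb3 hb4 hb5
          (fold_L1 M hline 8 (RB9 8) (7560 * betaK 10 8) 13 hcore)
      · intro fl hfl
        rw [Finset.card_le_one]
        intro G hG G' hG'
        obtain ⟨hGE, hclG, hrG, h10⟩ := hfl G hG
        obtain ⟨hGE', hclG', hrG', h10'⟩ := hfl G' hG'
        exact eq_of_ten_le_ncard_of_flats' M hline hplane hd (le_refl 8) hGE hclG hrG hGE' hclG' hrG' h10 h10'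
    · -- (i-b): the only flat with `≥ 9` points is `F`
      push Not at hnine
      have hcore := ncard_rank4_Icc_le_engine M hcirc hline hplane hten 8 9 (RM 8) 1 (min (5 * 8) M.E.ncard)
        (ncard_sUnion_circuitsLE_le_min M hd) ?_ ?_
      · rw [one_mul] at hcore
        refine le_max_of_le_left (le_max_of_le_right ?_)
        have h := topCount_le_Uform M p 8 hR hn hd hp (by norm_num) (RM 8) (7560 * betaK 10 8) (min (5 * 8) M.E.ncard) hb3 hb4 hb5
          (fold_L1 M hline 8 (RM 8) (7560 * betaK 10 8) (min (5 * 8) M.E.ncard) hcore)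
        rw [hn] at h
        exact h
      · intro G hG hcl hr h8 h9
        exact weight_eight_AB M hcirc hline hplane hG hcl hr (by omega) 8
      · intro fl hfl
        rw [Finset.card_le_one]
        intro G hG G' hG'
        obtain ⟨hGE, hclG, hrG, h9⟩ := hfl G hG
        obtain ⟨hGE', hclG', hrG', h9'⟩ := hfl G' hG'
        have e1 : G = F := hnine G ⟨hGE, hclG, hrG, h9⟩
        have e2 : G' = F := hnine G' ⟨hGE', hclG', hrG', h9'⟩
        rw [e1, e2]
  · -- (ii): no ten-point flat
    push Not at hten'
    have hcore := ncard_rank4_Icc_le_engine M hcirc hline hplane hten 8 10 (RB9 8) 0 (min (5 * 8) M.E.ncard)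
      (ncard_sUnion_circuitsLE_le_min M hd) hw9 ?_
    · rw [zero_mul] at hcore
      refine le_max_of_le_right ?_
      have h := topCount_le_Uform M p 8 hR hn hd hp (by norm_num) (RB9 8) 0 (min (5 * 8) M.E.ncard) hb3 hb4 hb5
        (fold_L1 M hline 8 (RB9 8) 0 (min (5 * 8) M.E.ncard) hcore)
      rw [hn] at h
      exact h
    · intro fl hfl
      have hemp : fl = ∅ := by
        rw [Finset.eq_empty_iff_forall_notMem]
        intro G hG
        obtain ⟨hGE, hclG, hrG, h10⟩ := hfl G hG
        exact hten' G ⟨hGE, hclG, hrG, h10⟩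
      rw [hemp, Finset.card_empty]

end S1

end PercRepro
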